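import Summits.QuantumFields.QCD.Theorems.PauliWegnerSeaFMClosureUnquenchedClosureC1
import Summits.QuantumFields.QCD.Theorems.PauliWegnerSeaFMClosureUnquenchedFibreBandLawC1
import Summits.QuantumFields.QCD.Theorems.PauliWegnerSeaFMClosureUnquenchedSideWitnessC1
import Summits.QuantumFields.QCD.Theorems.PauliWegnerSeaFMClosureUnquenchedHopping
import Summits.QuantumFields.QCD.Theorems.PauliWegnerSeaFMClosureUnquenchedResolvent

/-!
# Crux `FMClosureUnquenched` (stmt-QuantumFields-11512), line `von-mises-circles`, lead c2:
the REPAIRED closure and the kernel-checked reductions of the crux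

Everything here is about the route crux K2 `Summit.QuantumFields.QCD.Theses.PauliWegnerSea.FMClosureUnquenched`
(`= K1 → K3 → ∀ N_f reg m > 0, Input → Conclusion`, vocabulary of `Theorems/PauliWegnerSeaFMClosureUnquenchedDefs.lean`)
and uses only LANDED theorems of the line (fibre band law `c1_fibreBandLaw`, two-star package `stub_twoStar`, side
witnesses `c1_sideWitness`, closure helpers `c1_volume_bootstrap` / `c1_closure_rate` / `c1_shell_lower`, the hopping
window `ThickCollarFarStability.stub_hopping` and the collar resolvent algebra `ThickCollarFarStability.stub_resolvent`).

1. `closure_from_two` — **the repaired closure**: the finite-volume fractional-moment bootstrap of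
   Aizenman–Schenker–Friedrich–Hundertmark for the one-scale input WITH `2 ≤ ℓ₀` (the refuters' repair of corner A5 of
   the crux as typed), WITHOUT the hypothesis `UnitShellLowerBound` that `VonMisesCirclesC1.stub_closure` needs for the
   unit shell `ℓ₀ = 1`: `TwoStarBounds → FarStability → CollarResolventBounds → HoppingDecay → Input₂ → OutwardDecayWith`.
   With `2 ≤ ℓ₀` the size parameter `Θ_k = ℓ₀ (1 + |β_k|)` is `≥ 2` at every step, so ONE `q` beats every polynomial
   loss and the bootstrap runs at every `β_k ∈ ℝ` and every bare mass (hopping window: `HoppingDecay`; otherwise the probe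
   mass is in `[-9, 1]`).
2. `twoStarBounds_of_localCofactorDomination`, `collarResolventBounds_holds`, `hoppingDecay_holds` — the inputs of the
   closure that are theorems: everything except K1♭ `LocalCofactorDomination` and `FarStability`.
3. `outward_of_localCofactorDomination_farStability` — **K1♭ → (∀ N_f, FarStability N_f) → (Input₂ → OutwardDecayWith)**
   for EVERY regularisation and mass tuple (no sign condition on `β_k`, no bare-mass range, no mass positivity), and its
   unfolded form `coreOutward_of_localCofactorDomination_farStability` whose hypothesis and conclusion are, integrand by
   integrand, the texts of the proposed restatement `Cruxes/FMClosureUnquenched/K2Repaired.lean` (input with `2 ≤ ℓ₀`;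
   clause (ii) OUTWARD, i.e. for `K (1 + |log a_k|) ≤ a_k ‖v‖`).  So the repaired crux with antecedents
   (K1♭, FarStability) is closed by this file; what remains of K2 are exactly those two statements.
4. `fmClosureUnquenched_of_three` — the crux AS TYPED from the three open registered stubs of the skeleton
   (`LocalCofactorDomination`, `K1 → K3 → ∀ N_f, FarStability N_f`, and the corner statement
   `(∀ N_f, UnitShellLowerBound N_f) ∧ (∀ N_f reg m > 0, InwardExtension N_f reg m)` = A5 ∧ A6), i.e. the registered
   composition `FMClosureUnquenched_of_stubs` with its landed stubs inlined, now importable from `Theorems/`.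

No new definitions (the repaired input is written inline).  References: Aizenman–Schenker–Friedrich–Hundertmark,
CMP 224 (2001) 219, §2 and Thm 2 [AizenmanEtAl2001]; Montvay–Münster, *Quantum Fields on a Lattice* (CUP 1994) §5.1
[MontvayMunster1994].
-/

noncomputable section

open scoped BigOperators
open MeasureTheory Filter
open Literature.MathematicalPhysics.QuantumFieldTheory Literature.MathematicalPhysics.QuantumLattice
  Literature.Probability.LatticeModels
open Summit.QuantumFields.QCD.Theorems.VonMisesCircles
open Summit.QuantumFields.QCD.Theorems.VonMisesCirclesC1

namespace Summit.QuantumFields.QCD.Theorems.VonMisesCirclesC2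

/-! ## 1. The repaired closure (`2 ≤ ℓ₀`, no unit-shell hypothesis) -/

/-- **The repaired closure of crux stmt-QuantumFields-11512** (line `von-mises-circles`, lead c2): for every
regularisation and every mass tuple, the two-star bounds, far stability, the collar resolvent bounds and the hopping
decay turn the one-scale input WITH `2 ≤ ℓ₀` into the outward decay package `OutwardDecayWith` (decay of the
phase-quenched fractional moment at rate `δ a_k` beyond the input radius, k-uniform constants).  Same proof as
`VonMisesCirclesC1.stub_closure` with the size threshold `Θ := 2 ≤ ℓ₀ (1 + |β_k|)` read off the input, so that the
unit-shell corner never arises. [cite: AizenmanEtAl2001, §2 and Thm 2] -/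
theorem closure_from_two :
    ∀ (Nf : ℕ) (reg : QCDRegularisation Nf) (m : Fin Nf → ℝ),
      TwoStarBounds Nf → FarStability Nf → CollarResolventBounds → HoppingDecay Nf →
        (∀ q : ℕ, ∃ K₀ s : ℝ, 0 < s ∧ s < 1 ∧ ∀ᶠ k in atTop, ∃ ℓ₀ : ℕ, 2 ≤ ℓ₀ ∧ ℓ₀ ≤ reg.L k ∧
          (ℓ₀ : ℝ) * reg.a k ≤ K₀ * (1 + |Real.log (reg.a k)|) ∧
          ∀ S : ℕ, reg.L k ≤ S → ∀ (f : Fin Nf) (v : Literature.Probability.LatticeModels.Site 4),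
            v ∈ box 4 S → ‖v‖ = (ℓ₀ : ℝ) →
              (ℓ₀ : ℝ) ^ q * (1 + |reg.β k|) ^ q * cruxMoment Nf (reg.β k) (bareMass reg m k) S f v s ≤ 1) →
          ∃ (s δ C K₀ : ℝ) (ℓ₀ : ℕ → Fin Nf → ℕ), OutwardDecayWith Nf reg m s δ C K₀ ℓ₀ := by
  intro Nf reg m hTS hFS hCR hHD hIn
  classical
  obtain ⟨s₀, C, p, hs₀, _hs₀1, hC, hT⟩ := hTS
  obtain ⟨s₀', Cf, pf, θ, hs₀', _hs₀'1, hCf, hθ0, hθ1, hF⟩ := hFS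
  obtain ⟨CH, μ, hCH, hμ, hH⟩ := hHD
  obtain ⟨C₁, c₁, Cb, cb, CM, cM, hC₁, hc₁, hCb, hcb, hCM, hcM, hboot⟩ :=
    c1_volume_bootstrap hC hCf hθ0 hθ1 hT hF hCR
  -- exponent floor `σ` and size threshold `Θ = 2`
  obtain ⟨σ, hσ0, hσs₀, hσs₀', hσ12⟩ : ∃ σ : ℝ, 0 < σ ∧ σ ≤ s₀ ∧ σ ≤ s₀' ∧ σ ≤ 1 / 2 :=
    ⟨min (min s₀ s₀') (1 / 2), lt_min (lt_min hs₀ hs₀') (by norm_num),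
      (min_le_left _ _).trans (min_le_left _ _), (min_le_left _ _).trans (min_le_right _ _), min_le_right _ _⟩
  obtain ⟨Θ, hΘ1, hΘ2⟩ : ∃ Θ : ℝ, 1 < Θ ∧ Θ ≤ 2 := ⟨2, by norm_num, le_rfl⟩
  have hΘ0 : 0 < Θ := by linarith
  have hlogΘ : 0 < Real.log Θ := Real.log_pos hΘ1
  -- choice of `q`
  set A : ℝ := max (2 * Cb) (CM * Cb) with hA
  have hA2 : 2 * Cb ≤ A := le_max_left _ _
  have hAM : CM * Cb ≤ A := le_max_right _ _
  have hA1 : 1 ≤ A := by linarith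
  have hA0 : 0 < A := by linarith
  have hLA : 0 ≤ Real.log A / Real.log Θ := div_nonneg (Real.log_nonneg hA1) hlogΘ.le
  obtain ⟨q, hq⟩ := c1_exists_nat_mul_ge (θ * σ) (c₁ + cb + cM + 1 + Real.log A / Real.log Θ) (by positivity)
  set κ : ℝ := (q : ℝ) * σ with hκ
  have hκ0 : 0 ≤ κ := by positivity
  have hθκ : c₁ + cb + cM + 1 + Real.log A / Real.log Θ ≤ θ * κ := by rw [hκ]; linarith [hq]
  have hθκκ : θ * κ ≤ κ := by nlinarith
  have hQ1 : c₁ < κ := by linarith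
  have hQ2 : cb < θ * κ := by linarith
  have hΘA : ∀ e : ℝ, e ≤ -(Real.log A / Real.log Θ) → Θ ^ e ≤ A⁻¹ := fun e he =>
    (Real.rpow_le_rpow_of_exponent_le hΘ1.le he).trans_eq (c1_rpow_neg_log_div Θ A hΘ1 hA0)
  have hQ3 : Cb * Θ ^ (cb - θ * κ) ≤ 1 / 2 := by
    have h1 : Θ ^ (cb - θ * κ) ≤ A⁻¹ := hΘA _ (by linarith)
    calc Cb * Θ ^ (cb - θ * κ) ≤ Cb * A⁻¹ := mul_le_mul_of_nonneg_left h1 (by linarith)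
      _ ≤ Cb * (2 * Cb)⁻¹ := mul_le_mul_of_nonneg_left (inv_anti₀ (by linarith) hA2) (by linarith)
      _ = 1 / 2 := by field_simp
  have hQ4 : CM * Cb * Θ ^ (cM + cb - θ * κ) ≤ 1 := by
    have h1 : Θ ^ (cM + cb - θ * κ) ≤ A⁻¹ := hΘA _ (by linarith)
    calc CM * Cb * Θ ^ (cM + cb - θ * κ) ≤ CM * Cb * A⁻¹ := mul_le_mul_of_nonneg_left h1 (by positivity)
      _ ≤ A * A⁻¹ := mul_le_mul_of_nonneg_right hAM (inv_nonneg.2 hA0.le)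
      _ = 1 := mul_inv_cancel₀ hA0.ne'
  -- the input at this `q`
  obtain ⟨K₀, sq, hsq0, hsq1, hev⟩ := hIn q
  -- the exponent
  set t : ℝ := min σ sq with ht
  have ht0 : 0 < t := lt_min hσ0 hsq0
  have htσ : t ≤ σ := min_le_left _ _
  have htsq : t ≤ sq := min_le_right _ _
  have ht1 : t ≤ 1 := by linarith
  have ht1' : t < 1 := by linarith
  have hts : t ≤ s₀ := htσ.trans hσs₀
  have hts' : t ≤ s₀' := htσ.trans hσs₀'
  have hσts : σ ≤ t / sq := by
    rw [le_div_iff₀ hsq0, ht]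
    rcases le_total σ sq with h | h
    · rw [min_eq_left h]; nlinarith
    · rw [min_eq_right h]; nlinarith
  -- `K₀ > 0` (the input is non-vacuous at some step)
  have hK₀ : 0 < K₀ := by
    obtain ⟨k, ℓ₀, hℓ2, -, hℓK, -⟩ := hev.exists
    have h1 : (0 : ℝ) < ℓ₀ * reg.a k := mul_pos (by exact_mod_cast (by omega : 0 < ℓ₀)) (reg.a_pos k)
    have h2 : (0 : ℝ) < 1 + |Real.log (reg.a k)| := by positivity
    by_contra hK
    push Not at hK
    have : K₀ * (1 + |Real.log (reg.a k)|) ≤ 0 := mul_nonpos_of_nonpos_of_nonneg hK h2.le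
    linarith
  -- the rate arithmetic
  obtain ⟨δ, Cr, a₀, hδ, hCr, ha₀, hrate⟩ := c1_closure_rate Θ K₀ C₁ c₁ Cb cb θ κ hΘ1 hK₀ hC₁ hCb hQ1 hQ2
  -- the input radius as a function of the step
  let P : ℕ → ℕ → Prop := fun k ℓ₀ => 2 ≤ ℓ₀ ∧ ℓ₀ ≤ reg.L k ∧
    (ℓ₀ : ℝ) * reg.a k ≤ K₀ * (1 + |Real.log (reg.a k)|) ∧
    ∀ S : ℕ, reg.L k ≤ S → ∀ (f : Fin Nf) (v : Site 4), v ∈ box 4 S → ‖v‖ = (ℓ₀ : ℝ) →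
      (ℓ₀ : ℝ) ^ q * (1 + |reg.β k|) ^ q * cruxMoment Nf (reg.β k) (bareMass reg m k) S f v sq ≤ 1
  let ℓf : ℕ → ℕ := fun k => if h : ∃ ℓ₀, P k ℓ₀ then h.choose else 0
  have hℓf : ∀ k, (∃ ℓ₀, P k ℓ₀) → P k (ℓf k) := fun k h => by
    simp only [ℓf, dif_pos h]
    exact h.choose_spec
  -- eventual smallness of the spacing
  have hev_a₀ : ∀ᶠ k in atTop, reg.a k ≤ a₀ := reg.tendsto_a.eventually_le_const ha₀
  have hev_hop : ∀ᶠ k in atTop, reg.a k ≤ μ * t / δ := reg.tendsto_a.eventually_le_const (by positivity)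
  -- the package
  refine ⟨t, δ, max Cr CH, K₀, fun k _ => ℓf k, ht0, ht1', hδ, hCr.trans (le_max_left _ _), ?_, ?_, ?_⟩
  · filter_upwards [hev] with k hk f
    exact (hℓf k hk).2.2.1
  · filter_upwards [hev] with k hk f
    exact (hℓf k hk).2.1
  filter_upwards [hev, hev_a₀, hev_hop] with k hk hka hkh S hS f v hv hℓv
  obtain ⟨hℓ2, hℓL, hℓK, hshellIn⟩ := hℓf k hk
  change ((ℓf k : ℕ) : ℝ) ≤ ‖v‖ at hℓv
  set ℓ₀ : ℕ := ℓf k with hℓ₀def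
  have hℓ1 : 1 ≤ ℓ₀ := by omega
  have hmax0 : 0 ≤ max Cr CH := hCr.trans (le_max_left _ _)
  have hexp : ∀ x : ℝ, 0 ≤ Real.exp x := fun x => (Real.exp_pos x).le
  by_cases hhop : (41 / 10 : ℝ) ≤ |bareMass reg m k f + 4|
  · -- the hopping window
    have h := hH (reg.β k) (bareMass reg m k) f hhop S t ht0 ht1' v hv
    change cruxMoment Nf (reg.β k) (bareMass reg m k) S f v t ≤ CH * Real.exp (-(μ * t * ‖v‖)) at h
    refine h.trans (mul_le_mul (le_max_right _ _) (Real.exp_le_exp.2 (neg_le_neg ?_)) (hexp _) hmax0)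
    have h1 : δ * reg.a k ≤ μ * t := by rwa [le_div_iff₀ hδ, mul_comm] at hkh
    calc δ * (reg.a k * ‖v‖) = (δ * reg.a k) * ‖v‖ := by ring
      _ ≤ μ * t * ‖v‖ := mul_le_mul_of_nonneg_right h1 (norm_nonneg _)
  · -- outside the hopping window: the bootstrap
    have habs : |bareMass reg m k f + 4| < 41 / 10 := lt_of_not_ge hhop
    obtain ⟨hlo, hhi⟩ := abs_lt.1 habs
    have hm9 : -9 ≤ bareMass reg m k f := by linarith only [hlo]
    have hm1 : bareMass reg m k f ≤ 1 := by linarith only [hhi]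
    have hβ1 : 1 ≤ 1 + |reg.β k| := by have := abs_nonneg (reg.β k); linarith only [this]
    have hℓ2r : (2 : ℝ) ≤ ℓ₀ := by exact_mod_cast hℓ2
    set Θk : ℝ := (ℓ₀ : ℝ) * (1 + |reg.β k|) with hΘk
    have hℓΘ : (ℓ₀ : ℝ) ≤ Θk := by rw [hΘk]; exact le_mul_of_one_le_right (Nat.cast_nonneg _) hβ1
    -- the size threshold is met because `2 ≤ ℓ₀` (no unit-shell corner)
    have hΘΘk : Θ ≤ Θk := hΘ2.trans (hℓ2r.trans hℓΘ)
    have hΘk1 : 1 ≤ Θk := hΘ1.le.trans hΘΘk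
    have hΘk0 : 0 < Θk := by linarith only [hΘk1]
    -- the shell input at exponent `t`
    have hshell : ∀ w : Site 4, w ∈ box 4 S → ‖w‖ = (ℓ₀ : ℝ) →
        pqE Nf S (reg.β k) (bareMass reg m k) (fun U => blockNorm (wilsonD U (bareMass reg m k f))⁻¹ 0
          (Torus.proj (2 * S + 1) w) ^ t) ≤ ((ℓ₀ : ℝ) * (1 + |reg.β k|)) ^ (-κ) := by
      intro w hw hwn
      have h := c1_shell_lower (reg.β k) (bareMass reg m k) S f w q ℓ₀ ht0 htsq hsq1.le hσts hℓ1
        (hshellIn S hS f w hw hwn)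
      rwa [c1_cruxMoment_eq_pqE, c1_proj_zero] at h
    obtain ⟨hB1, hB2⟩ := hboot (reg.β k) t (bareMass reg m k) f S ℓ₀ κ ht0 ht1 hts hts' hm9 hm1 hℓ1
      (hℓL.trans hS) hκ0 hshell
    -- the quantity, the distance
    have hE : cruxMoment Nf (reg.β k) (bareMass reg m k) S f v t =
        pqE Nf S (reg.β k) (bareMass reg m k) (fun U => blockNorm (wilsonD U (bareMass reg m k f))⁻¹ 0
          (Torus.proj (2 * S + 1) v) ^ t) := by
      rw [c1_cruxMoment_eq_pqE, c1_proj_zero]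
    have hnorm : ‖v‖ = (Site.supNorm v : ℝ) := c1_norm_eq_supNorm v
    have hn : ℓ₀ ≤ Site.supNorm v := by
      have : (ℓ₀ : ℝ) ≤ Site.supNorm v := by rw [← hnorm]; exact hℓv
      exact_mod_cast this
    have hvS : Site.supNorm v ≤ S := mem_box_iff_supNorm_le.1 hv
    -- the rate-free bound
    have hrf : cruxMoment Nf (reg.β k) (bareMass reg m k) S f v t ≤ C₁ * Θk ^ (c₁ - κ) := by
      rw [hE]; exact hB1 v hv hn
    -- monotonicity in the size parameter
    have hmono : ∀ e : ℝ, e ≤ 0 → Θk ^ e ≤ Θ ^ e := fun e he => Real.rpow_le_rpow_of_nonpos hΘ0 hΘΘk he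
    have hbsmall : Cb * Θk ^ (cb - θ * κ) ≤ 1 / 2 :=
      (mul_le_mul_of_nonneg_left (hmono _ (by linarith only [hQ2])) (by linarith only [hCb])).trans hQ3
    -- conclusion through the rate arithmetic
    suffices hfin : cruxMoment Nf (reg.β k) (bareMass reg m k) S f v t ≤
        Cr * Real.exp (-(δ * (reg.a k * (Site.supNorm v : ℕ)))) by
      rw [hnorm]
      exact hfin.trans (mul_le_mul_of_nonneg_right (le_max_left _ _) (hexp _))
    by_cases hfar : 4 * (3 * ℓ₀ + 4) ≤ Site.supNorm v
    · -- far: the collar bound is available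
      have hfit : 3 * ℓ₀ + 4 ≤ S := by omega
      obtain ⟨b, M, hb0, hb, hM0, hM, hEb⟩ := hB2 hfit (hbsmall.trans (by norm_num)) v hv
      refine hrate (reg.a k) Θk b M _ ℓ₀ (Site.supNorm v) (reg.a_pos k) hka hℓ1 hΘΘk hℓΘ hℓK hn hrf ?_
      intro _
      refine ⟨hb0, hb.trans hbsmall, hb, hM0, ?_, by rw [hE]; exact hEb⟩
      -- `M b ≤ 1`
      have h1 : M * b ≤ (CM * Θk ^ cM) * (Cb * Θk ^ (cb - θ * κ)) := mul_le_mul hM hb hb0 (by positivity)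
      have h2 : (CM * Θk ^ cM) * (Cb * Θk ^ (cb - θ * κ)) = CM * Cb * Θk ^ (cM + cb - θ * κ) := by
        rw [show cM + cb - θ * κ = cM + (cb - θ * κ) by ring, Real.rpow_add hΘk0]; ring
      have h3 : CM * Cb * Θk ^ (cM + cb - θ * κ) ≤ CM * Cb * Θ ^ (cM + cb - θ * κ) :=
        mul_le_mul_of_nonneg_left (hmono _ (by linarith only [hθκ, hc₁, hLA])) (mul_nonneg hCM (by linarith only [hCb]))
      linarith only [h1, h2, h3, hQ4]
    · -- near: only the rate-free bound is needed
      exact hrate (reg.a k) Θk 0 0 _ ℓ₀ (Site.supNorm v) (reg.a_pos k) hka hℓ1 hΘΘk hℓΘ hℓK hn hrf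
        (fun h => absurd h hfar)

/-- The repaired closure with the crux's (unused) mass-positivity hypothesis kept in front (registered sub-goal
`stub_closureRepaired` of stmt-QuantumFields-11512). [cite: AizenmanEtAl2001, §2 and Thm 2] -/
theorem stub_closureRepaired :
    ∀ (Nf : ℕ) (reg : QCDRegularisation Nf) (m : Fin Nf → ℝ), (∀ f, 0 < m f) →
      TwoStarBounds Nf → FarStability Nf → CollarResolventBounds → HoppingDecay Nf →
        (∀ q : ℕ, ∃ K₀ s : ℝ, 0 < s ∧ s < 1 ∧ ∀ᶠ k in atTop, ∃ ℓ₀ : ℕ, 2 ≤ ℓ₀ ∧ ℓ₀ ≤ reg.L k ∧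
          (ℓ₀ : ℝ) * reg.a k ≤ K₀ * (1 + |Real.log (reg.a k)|) ∧
          ∀ S : ℕ, reg.L k ≤ S → ∀ (f : Fin Nf) (v : Literature.Probability.LatticeModels.Site 4),
            v ∈ box 4 S → ‖v‖ = (ℓ₀ : ℝ) →
              (ℓ₀ : ℝ) ^ q * (1 + |reg.β k|) ^ q * cruxMoment Nf (reg.β k) (bareMass reg m k) S f v s ≤ 1) →
          ∃ (s δ C K₀ : ℝ) (ℓ₀ : ℕ → Fin Nf → ℕ), OutwardDecayWith Nf reg m s δ C K₀ ℓ₀ :=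
  fun Nf reg m _ => closure_from_two Nf reg m

/-! ## 2. The inputs of the closure that are theorems -/

/-- The fibre band law holds outright (landed `VonMisesCirclesC1.c1_fibreBandLaw`, the let-free registered form,
specialised back to the `let`s of `FibreBandLaw` by `rfl`). [folklore] -/
theorem fibreBandLaw_holds : FibreBandLaw := by
  intro n d
  obtain ⟨s₀, C, p, h0, hC, h⟩ := c1_fibreBandLaw n d
  refine ⟨s₀, C, p, h0, hC, ?_⟩
  intro N _ R hR U β P Q hP hQ
  exact h N R hR U β P Q hP hQ _ rfl _ rfl _ rfl _ rfl

/-- **The two-star package from K1♭ alone**: `LocalCofactorDomination → ∀ N_f, TwoStarBounds N_f` (the fibre band law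
and the side witnesses are theorems). [folklore] -/
theorem twoStarBounds_of_localCofactorDomination (hK : LocalCofactorDomination) (Nf : ℕ) : TwoStarBounds Nf :=
  stub_twoStar fibreBandLaw_holds hK c1_sideWitness Nf

/-- The collar resolvent bounds hold (landed `ThickCollarFarStability.stub_resolvent`, `cT = 4`; the registered
unfolded text is `CollarResolventBounds` definitionally). [cite: AizenmanEtAl2001, §2 (2.11)–(2.16)] -/
theorem collarResolventBounds_holds : CollarResolventBounds :=
  _root_.Summit.QuantumFields.QCD.Theorems.ThickCollarFarStability.stub_resolvent

/-- The hopping decay holds for every flavour number (landed `ThickCollarFarStability.stub_hopping`, `C = 1440`,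
`μ = log (41/40)`; the registered unfolded text is `HoppingDecay N_f` definitionally). [folklore] -/
theorem hoppingDecay_holds (Nf : ℕ) : HoppingDecay Nf :=
  _root_.Summit.QuantumFields.QCD.Theorems.ThickCollarFarStability.stub_hopping Nf

/-! ## 3. K1♭ → FarStability → the repaired crux -/

/-- **K1♭ and far stability give the outward package for the repaired input**, for EVERY regularisation and every
mass tuple: `LocalCofactorDomination → (∀ N_f, FarStability N_f) → ∀ N_f reg m, Input₂ → ∃ …, OutwardDecayWith …`
(`Input₂` = the crux's one-scale input with `2 ≤ ℓ₀`). [cite: AizenmanEtAl2001, Thm 2] -/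
theorem outward_of_localCofactorDomination_farStability (hK : LocalCofactorDomination)
    (hF : ∀ Nf : ℕ, FarStability Nf) :
    ∀ (Nf : ℕ) (reg : QCDRegularisation Nf) (m : Fin Nf → ℝ),
      (∀ q : ℕ, ∃ K₀ s : ℝ, 0 < s ∧ s < 1 ∧ ∀ᶠ k in atTop, ∃ ℓ₀ : ℕ, 2 ≤ ℓ₀ ∧ ℓ₀ ≤ reg.L k ∧
        (ℓ₀ : ℝ) * reg.a k ≤ K₀ * (1 + |Real.log (reg.a k)|) ∧
        ∀ S : ℕ, reg.L k ≤ S → ∀ (f : Fin Nf) (v : Literature.Probability.LatticeModels.Site 4),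
          v ∈ box 4 S → ‖v‖ = (ℓ₀ : ℝ) →
            (ℓ₀ : ℝ) ^ q * (1 + |reg.β k|) ^ q * cruxMoment Nf (reg.β k) (bareMass reg m k) S f v s ≤ 1) →
        ∃ (s δ C K₀ : ℝ) (ℓ₀ : ℕ → Fin Nf → ℕ), OutwardDecayWith Nf reg m s δ C K₀ ℓ₀ :=
  fun Nf reg m hIn =>
    closure_from_two Nf reg m (twoStarBounds_of_localCofactorDomination hK Nf) (hF Nf)
      collarResolventBounds_holds (hoppingDecay_holds Nf) hIn

/-- **The repaired core of K2, closed modulo K1♭ and far stability** — hypothesis and conclusion in the unfolded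
vocabulary of the route (integrands byte-identical with `FMClosureUnquenched` and with the proposed restatement
`K2Repaired.lean`): for every `N_f`, every regularisation and every mass tuple, the one-scale input WITH `2 ≤ ℓ₀` implies
clause (ii) OUTWARD — for some `s, δ, C, K`, eventually in `k`, for all `S ≥ L_k`, all flavours and all `v ∈ box S` with
`K (1 + |log a_k|) ≤ a_k ‖v‖`, the phase-quenched fractional moment is `≤ C e^{-δ a_k ‖v‖}`.  No sign condition on `β_k`,
no bare-mass range and no mass positivity are needed. [cite: AizenmanEtAl2001, Thm 2] -/
theorem coreOutward_of_localCofactorDomination_farStability (hK : LocalCofactorDomination)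
    (hF : ∀ Nf : ℕ, FarStability Nf) :
    ∀ (Nf : ℕ) (reg : QCDRegularisation Nf) (m : Fin Nf → ℝ),
      (∀ q : ℕ, ∃ K₀ s : ℝ, 0 < s ∧ s < 1 ∧ ∀ᶠ k in atTop, ∃ ℓ₀ : ℕ, 2 ≤ ℓ₀ ∧ ℓ₀ ≤ reg.L k ∧
        (ℓ₀ : ℝ) * reg.a k ≤ K₀ * (1 + |Real.log (reg.a k)|) ∧
        ∀ S : ℕ, reg.L k ≤ S → ∀ (f : Fin Nf) (v : Literature.Probability.LatticeModels.Site 4),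
          v ∈ box 4 S → ‖v‖ = (ℓ₀ : ℝ) →
            (ℓ₀ : ℝ) ^ q * (1 + |reg.β k|) ^ q *
              ((∫ U : GaugeConfig 4 (2 * S + 1) (Matrix.specialUnitaryGroup (Fin 3) ℂ),
                  ‖(diracMatrix U fun fl => reg.mcrit k + reg.a k * m fl / reg.Zm k).det‖ *
                    (∑ a : Fin 3, ∑ i : Fin 4, ∑ b : Fin 3, ∑ j : Fin 4,
                      ‖(diracMatrix U fun fl => reg.mcrit k + reg.a k * m fl / reg.Zm k)⁻¹
                        (quarkEquiv (f, (Torus.proj (2 * S + 1) 0, a, i)))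
                        (quarkEquiv (f, (Torus.proj (2 * S + 1) (v), b, j)))‖) ^ s
                  ∂(wilsonMeasure (fundamentalRep (Fin 3)) (reg.β k))) /
                (∫ U : GaugeConfig 4 (2 * S + 1) (Matrix.specialUnitaryGroup (Fin 3) ℂ),
                  ‖(diracMatrix U fun fl => reg.mcrit k + reg.a k * m fl / reg.Zm k).det‖
                  ∂(wilsonMeasure (fundamentalRep (Fin 3)) (reg.β k)))) ≤ 1) →
      ∃ s δ C K : ℝ, 0 < s ∧ s < 1 ∧ 0 < δ ∧ ∀ᶠ k in atTop, ∀ S : ℕ, reg.L k ≤ S →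
        ∀ (f : Fin Nf) (v : Literature.Probability.LatticeModels.Site 4), v ∈ box 4 S →
          K * (1 + |Real.log (reg.a k)|) ≤ reg.a k * ‖v‖ →
            (∫ U : GaugeConfig 4 (2 * S + 1) (Matrix.specialUnitaryGroup (Fin 3) ℂ),
                ‖(diracMatrix U fun fl => reg.mcrit k + reg.a k * m fl / reg.Zm k).det‖ *
                  (∑ a : Fin 3, ∑ i : Fin 4, ∑ b : Fin 3, ∑ j : Fin 4,
                    ‖(diracMatrix U fun fl => reg.mcrit k + reg.a k * m fl / reg.Zm k)⁻¹
                      (quarkEquiv (f, (Torus.proj (2 * S + 1) 0, a, i)))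
                      (quarkEquiv (f, (Torus.proj (2 * S + 1) (v), b, j)))‖) ^ s
                ∂(wilsonMeasure (fundamentalRep (Fin 3)) (reg.β k))) /
              (∫ U : GaugeConfig 4 (2 * S + 1) (Matrix.specialUnitaryGroup (Fin 3) ℂ),
                ‖(diracMatrix U fun fl => reg.mcrit k + reg.a k * m fl / reg.Zm k).det‖
                ∂(wilsonMeasure (fundamentalRep (Fin 3)) (reg.β k))) ≤
              C * Real.exp (-(δ * (reg.a k * ‖v‖))) := by
  intro Nf reg m hIn
  -- the hypothesis is `Input₂` of `outward_of_localCofactorDomination_farStability`, definitionally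
  obtain ⟨s, δ, C, K₀, ℓ₀, hs0, hs1, hδ, _hC, hwin, -, hdec⟩ :=
    outward_of_localCofactorDomination_farStability hK hF Nf reg m hIn
  refine ⟨s, δ, C, K₀, hs0, hs1, hδ, ?_⟩
  filter_upwards [hwin, hdec] with k hkwin hk S hS f v hv hfar
  have hℓ : (ℓ₀ k f : ℝ) ≤ ‖v‖ := by
    have ha : 0 < reg.a k := reg.a_pos k
    have h1 : (ℓ₀ k f : ℝ) * reg.a k ≤ reg.a k * ‖v‖ := (hkwin f).trans hfar
    nlinarith
  exact hk S hS f v hv hℓ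

/-! ## 4. The crux as typed from the three open stubs of the registered skeleton -/

/-- Merging the outward and inward packages at a common exponent `s` into the crux's `Conclusion` (`δ = min`,
`C = max`); verbatim the skeleton's `conclusion_of_outward_inward`. [folklore] -/
theorem conclusion_of_outward_inward {Nf : ℕ} (reg : QCDRegularisation Nf) (m : Fin Nf → ℝ)
    {s δ C K₀ δ' C' : ℝ} {ℓ₀ : ℕ → Fin Nf → ℕ}
    (hout : OutwardDecayWith Nf reg m s δ C K₀ ℓ₀) (hin : InwardDecayWith Nf reg m s δ' C' ℓ₀) :
    Conclusion Nf reg m := by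
  obtain ⟨hs0, hs1, hδ, hC, -, -, hev⟩ := hout
  obtain ⟨hδ', hC', hev'⟩ := hin
  refine ⟨s, min δ δ', max C C', hs0, hs1, lt_min hδ hδ', ?_⟩
  filter_upwards [hev, hev'] with k hk hk' S hS f v hv
  have ht : 0 ≤ reg.a k * ‖v‖ := mul_nonneg (reg.a_pos k).le (norm_nonneg v)
  have hmax : 0 ≤ max C C' := le_trans hC (le_max_left _ _)
  by_cases h : (ℓ₀ k f : ℝ) ≤ ‖v‖
  · calc cruxMoment Nf (reg.β k) (bareMass reg m k) S f v s
          ≤ C * Real.exp (-(δ * (reg.a k * ‖v‖))) := hk S hS f v hv h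
      _ ≤ max C C' * Real.exp (-(min δ δ' * (reg.a k * ‖v‖))) := by
          apply mul_le_mul (le_max_left _ _) _ (Real.exp_pos _).le hmax
          exact Real.exp_le_exp.mpr (neg_le_neg (mul_le_mul_of_nonneg_right (min_le_left _ _) ht))
  · have h : ‖v‖ < (ℓ₀ k f : ℝ) := lt_of_not_ge h
    calc cruxMoment Nf (reg.β k) (bareMass reg m k) S f v s
          ≤ C' * Real.exp (-(δ' * (reg.a k * ‖v‖))) := hk' S hS f v hv h
      _ ≤ max C C' * Real.exp (-(min δ δ' * (reg.a k * ‖v‖))) := by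
          apply mul_le_mul (le_max_right _ _) _ (Real.exp_pos _).le hmax
          exact Real.exp_le_exp.mpr (neg_le_neg (mul_le_mul_of_nonneg_right (min_le_right _ _) ht))

/-- **The crux AS TYPED from its three open registered stubs** (skeleton `Cruxes/FMClosureUnquenched/Lines/
von_mises_circles_c1.lean`, composition `FMClosureUnquenched_of_stubs` with the landed stubs inlined): uniform cofactor
domination K1♭, far stability (threaded through K1 and K3 as registered) and the corner statement A5 ∧ A6 imply
`FMClosureUnquenched`.  The corner statement is the part of the crux as typed that the leads hold misstated
(`K2Repaired.lean`); items 1–3 above do not use it. [cite: AizenmanEtAl2001, Thm 2] -/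
theorem fmClosureUnquenched_of_three (hK : LocalCofactorDomination)
    (hF : Summit.QuantumFields.QCD.Theses.PauliWegnerSea.FibreCofactorDomination →
      Summit.QuantumFields.QCD.Theses.PauliWegnerSea.TiltedFlatness → ∀ Nf : ℕ, FarStability Nf)
    (hcorner : (∀ Nf : ℕ, UnitShellLowerBound Nf) ∧
      (∀ (Nf : ℕ) (reg : QCDRegularisation Nf) (m : Fin Nf → ℝ), (∀ f, 0 < m f) →
        InwardExtension Nf reg m)) :
    Summit.QuantumFields.QCD.Theses.PauliWegnerSea.FMClosureUnquenched := by
  rw [crux_iff]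
  intro hK1 hK3 Nf reg m hm hin
  have hT : TwoStarBounds Nf := twoStarBounds_of_localCofactorDomination hK Nf
  obtain ⟨s, δ, C, K₀, ℓ₀, hout⟩ :=
    stub_closure Nf reg m hm hT (hF hK1 hK3 Nf) collarResolventBounds_holds (hcorner.1 Nf)
      (hoppingDecay_holds Nf) hin
  obtain ⟨δ', C', hinw⟩ := hcorner.2 Nf reg m hm hT hin s δ C K₀ ℓ₀ hout
  exact conclusion_of_outward_inward reg m hout hinw

end Summit.QuantumFields.QCD.Theorems.VonMisesCirclesC2
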